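import Summits.QuantumFields.YangMills.Theorems.UnitScaleTiltProp7SectET3HilbertLettersT3
import Summits.QuantumFields.YangMills.Theorems.UnitScaleTiltProp7LandauDictT3
import HarnessLib

/-!
# Route `UnitScaleTilt`, crux K1 «MinimiserStabilityRegPr» (stmt-QuantumFields-19200), EX row `hGF` — the SMALL-MEMBER branch of the curved target `hT`,
# exit (α)(a) brick (3)-D — **THE MEMBER'S FIRST-ORDER LETTERS `D_{U₀}` (3.3) AND `D*_{U₀}` (3.8) AT A DIAGONAL BACKGROUND, ENTRY BY ENTRY:
# EVERY MATRIX ENTRY `(r, s)` IS A SCALAR TWISTED DIFFERENCE WITH THE UNIT TWIST `ω_{rs}(b) = d_r(b)·conj(d_s(b))`**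

Cell `ym3-torus` (HUMAN RULING D-0037: YM₃ on T³ is ladder rung R3 — NOT d = 4, NOT infinite volume, NOT a mass gap, NOT Clay).  Width seat `ym3-torus-px12` (gen 14),
OFFER 2026-08-30 02:26Z on px10 g10's (α)(a) pen (★★OWNER WORD 79 (a); LOCATE-SMALL-MEMBERS §(vi), 19200 evidence #57–#59; px10's brick (1) =
✓`Theorems/UnitScaleTiltToronTwistedMultipliers`).  THEOREMS ONLY (0 `def`, 0 `sorry`); `--supports stmt-QuantumFields-19200 --as helper`, count-neutral.
HONEST LABEL (★★OWNER RULING №33 (6)): pointwise stencil bookkeeping at a diagonal background; nothing of the twisted coercivity (bricks (2)–(4)), of `hT`, `hGF`, EX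
or the crux is proved here.

WHY.  After a global gauge a toron is a CONSTANT ABELIAN background: every bond variable is a diagonal `SU(2)` matrix `U₀(b) = diag(d₀(b), d₁(b))` with unit entries
(for a toron, `d(b)` depends on the direction `b.dir` only).  Conjugation by a diagonal unitary acts on `M₂(ℂ)` ENTRYWISE: `(diag d · M · (diag d)^*)_{rs} = d_r·conj(d_s)·M_{rs}`
(§1).  Hence the member's covariant derivative (3.3) `(D_{U₀}λ)(b) = η⁻¹·(U₀(b)λ(b₊)U₀(b)⁻¹ − λ(b₋))` (✓`Prop7SectET3HilbertLetters.DL2_apply`) and its adjoint (3.8)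
(✓`DstarL2_apply`) split into four SCALAR twisted differences, one per matrix entry, with unit twists `ω_{rs}(b) = d_r(b)·conj(d_s(b))` (§2–§3): the diagonal entries
are FLAT (`ω_{rr} = 1`, §1), the off-diagonal entries carry the charge-`±2` phases (`ω_{01} = conj(ω_{10})`).  At a background constant in each direction these are exactly the
translation-invariant operators `c·(ω_ν S_ν − 1)` that px10's brick (1) diagonalises in the standard DFT (✓`ToronTwistedMultipliers.dftV_mul_twistedDiff`, symbol = the flat
symbol at a shifted REAL momentum, ✓`twistedSym_emb`).

WHAT IS PROVED (ns `…Theorems.ToronSectorStencils`; member letters `toL2`, `toL2S`, `DL2`, `DstarL2`, `eta` of ✓`Prop7SectET3HilbertLettersT3`).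
* §1 `diagonal_conj_apply` (`(diag d·M·(diag d)^*)_{rs} = d_r·conj(d_s)·M_{rs}`), `star_diagonal_conj_apply` (the inverse conjugation: `conj(d_r)·d_s·M_{rs}`),
  `mul_conj_self_of_norm_eq_one` (`‖d_r‖ = 1 ⇒ d_r·conj(d_r) = 1`: diagonal sectors are flat), `norm_mul_conj_eq_one` (`‖ω_{rs}‖ = 1`: the twist is a unit),
  `conj_twist` (`conj(ω_{rs}) = ω_{sr}`).
* §2 ★★ `DL2_apply_entry_of_diagonal` — (3.3) at ANY bondwise-diagonal background: `(D_{U₀}λ)(b)_{rs} = η⁻¹·(d_r(b)conj(d_s(b))·λ(b₊)_{rs} − λ(b₋)_{rs})`;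
  ★★ `DL2_apply_entry_of_dirDiagonal` — the toron case `d(b) = δ(b.dir)`.
* §3 ★★ `DstarL2_apply_entry_of_diagonal` — (3.8) likewise: `(D*_{U₀}A)(x)_{rs} = η⁻¹·Σ_μ (conj(d_r)d_s·A(x−e_μ,x)_{rs} − A(x,x+e_μ)_{rs})` with `d = d(x−e_μ, x)`;
  ★★ `DstarL2_apply_entry_of_dirDiagonal` — the toron case.
* §4 (v1.1) ★★ `covLapSite_apply_entry_of_dirDiagonal_raw` (`Δ^η = D*D` composed entrywise at a toron) and
  ★★★ `covLapSite_apply_entry_of_dirDiagonal` — with unit phases the `(r, s)` entry of `Δ^η_{U₀}λ` is the TWISTED SCALAR LAPLACIAN `η⁻²Σ_μ(2λ(x) − conj(ω)λ(x−e_μ) − ωλ(x+e_μ))_{rs}`;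
  `covLapSite_apply_diagEntry_of_dirDiagonal` (diagonal entries = FLAT Laplacian).
HONEST SCOPE.  Entrywise identities on the route carriers; the `Tor N` re-indexing of the site carrier (px10's brick (2) seam), the `Q_k`∕`topMean` sectors, and every bound
are NOT here.

References: T. Bałaban, CMP **99** (1985) 389–434 [Balaban1985BackgroundPropagators] ((3.3) p.391, (3.5) p.391, (3.8) p.392, Thm 3.11 p.416);
CMP **95** (1984) 17–40 [Balaban1984PropagatorsI] ((1.29)–(1.31) p.23).
-/

set_option autoImplicit false

noncomputable section

open scoped BigOperators ComplexConjugate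

namespace Summit.QuantumFields.YangMills.Theorems.ToronSectorStencils

open Literature.MathematicalPhysics.QuantumFieldTheory.Balaban1983to89
open Literature.MathematicalPhysics.QuantumFieldTheory.Balaban1983to89.T3ContinuumYM3Torus
open T3SectALandauChart (eta)
open Summit.QuantumFields.YangMills.Theorems.Prop7SectET3Transport (siteEquiv bondEquiv bgOfCfg val_bgOfCfg isUnitaryBg_bgOfCfg)
open Summit.QuantumFields.YangMills.Theorems.Prop7SectET3HilbertLetters (toL2 toL2S DL2 DstarL2 DL2_apply DstarL2_apply)

/-! ## §1 Conjugation by a diagonal unitary acts entrywise -/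

section Algebra

variable {m : Type*} [Fintype m] [DecidableEq m]

/-- **ENTRYWISE CONJUGATION**: `(diag d · M · (diag d)^*)_{rs} = d_r·conj(d_s)·M_{rs}`. [folklore] -/
theorem diagonal_conj_apply (d : m → ℂ) (M : Matrix m m ℂ) (r s : m) :
    (Matrix.diagonal d * M * star (Matrix.diagonal d)) r s = d r * star (d s) * M r s := by
  rw [Matrix.star_eq_conjTranspose, Matrix.diagonal_conjTranspose, Matrix.mul_diagonal, Matrix.diagonal_mul]
  simp only [Pi.star_apply]
  ring

/-- The inverse conjugation: `((diag d)^* · M · diag d)_{rs} = conj(d_r)·d_s·M_{rs}`. [folklore] -/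
theorem star_diagonal_conj_apply (d : m → ℂ) (M : Matrix m m ℂ) (r s : m) :
    (star (Matrix.diagonal d) * M * Matrix.diagonal d) r s = star (d r) * d s * M r s := by
  rw [Matrix.star_eq_conjTranspose, Matrix.diagonal_conjTranspose, Matrix.mul_diagonal, Matrix.diagonal_mul]
  simp only [Pi.star_apply]
  ring

omit [Fintype m] [DecidableEq m] in
/-- **DIAGONAL SECTORS ARE FLAT**: a unit entry satisfies `d_r·conj(d_r) = 1`. [folklore] -/
theorem mul_conj_self_of_norm_eq_one {d : m → ℂ} (hd : ∀ i, ‖d i‖ = 1) (r : m) : d r * star (d r) = 1 := by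
  rw [Complex.star_def, Complex.mul_conj, Complex.normSq_eq_norm_sq, hd r]
  norm_num

omit [Fintype m] [DecidableEq m] in
/-- Flat from the other side: `conj(d_r)·d_r = 1`. [folklore] -/
theorem conj_mul_self_of_norm_eq_one {d : m → ℂ} (hd : ∀ i, ‖d i‖ = 1) (r : m) : star (d r) * d r = 1 := by
  rw [mul_comm]; exact mul_conj_self_of_norm_eq_one hd r

omit [Fintype m] [DecidableEq m] in
/-- **THE TWIST IS A UNIT**: `‖d_r·conj(d_s)‖ = 1` for unit entries — the hypothesis `‖ω‖ = 1` of ✓`ToronTwistedMultipliers.norm_twistedSymbol_sq`. [folklore] -/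
theorem norm_mul_conj_eq_one {d : m → ℂ} (hd : ∀ i, ‖d i‖ = 1) (r s : m) : ‖d r * star (d s)‖ = 1 := by
  rw [norm_mul, Complex.star_def, Complex.norm_conj, hd r, hd s, mul_one]

omit [Fintype m] [DecidableEq m] in
/-- The charge-conjugate sectors carry conjugate twists: `conj(d_r·conj(d_s)) = d_s·conj(d_r)`. [folklore] -/
theorem conj_twist (d : m → ℂ) (r s : m) : star (d r * star (d s)) = d s * star (d r) := by
  rw [star_mul, star_star]

end Algebra

/-! ## §2 (3.3) `D_{U₀}` at a diagonal background, entry by entry -/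

section Derivative

variable {F : T3Family} {n K : ℕ} {c₀ : ℝ} [Fact (0 < c₀)]

/-- ★★ **(3.3) AT A BONDWISE-DIAGONAL BACKGROUND, ENTRYWISE**: if `U₀(b) = diag(d(b))` for every bond, then for every gauge parameter `λ` and every matrix entry
`(r, s)`: `(D_{U₀}λ)(b)_{rs} = η⁻¹·(d_r(b)·conj(d_s(b))·λ(b₊)_{rs} − λ(b₋)_{rs})` — a scalar twisted forward difference with the unit twist `ω_{rs}(b)`.
[cite: Balaban1985BackgroundPropagators, (3.3) p.391, (3.5) p.391] -/
theorem DL2_apply_entry_of_diagonal (U₀ : GaugeField (F.P K) 0 (Matrix.specialUnitaryGroup (Fin 2) ℂ)) (d : PBond (F.P K) 0 → Fin 2 → ℂ)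
    (hU : ∀ b, ((U₀ b : Matrix.specialUnitaryGroup (Fin 2) ℂ) : Matrix (Fin 2) (Fin 2) ℂ) = Matrix.diagonal (d b))
    (l : Site (F.P K) 0 → Matrix (Fin 2) (Fin 2) ℂ) (b : PBond (F.P K) 0) (r s : Fin 2) :
    (toL2 F K c₀).symm (DL2 F n K c₀ U₀ (toL2S F K c₀ l)) b r s =
      (((eta F n K : ℝ) : ℂ)⁻¹) * (d b r * star (d b s) * l b.tgt r s - l b.src r s) := by
  have hinv : ((((bgOfCfg F K U₀ (bondEquiv F K b))⁻¹ : (Matrix (Fin 2) (Fin 2) ℂ)ˣ) : Matrix (Fin 2) (Fin 2) ℂ)) =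
      star (((U₀ b : Matrix.specialUnitaryGroup (Fin 2) ℂ) : Matrix (Fin 2) (Fin 2) ℂ)) := by
    rw [isUnitaryBg_bgOfCfg, val_bgOfCfg, Equiv.symm_apply_apply]
  rw [DL2_apply, hinv, hU b, Matrix.smul_apply, Matrix.sub_apply, diagonal_conj_apply, smul_eq_mul]

/-- ★★ **THE TORON CASE** — background constant in each direction, `U₀(⟨x, ν⟩) = diag(δ(ν))`: `(D_{U₀}λ)(b)_{rs} = η⁻¹·(δ_r(b.dir)conj(δ_s(b.dir))·λ(b₊)_{rs} − λ(b₋)_{rs})` —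
the translation-INVARIANT twisted difference `η⁻¹(ω_{rs,ν}S_ν − 1)` of ✓`ToronTwistedMultipliers` on the `(r, s)` entry. [cite: Balaban1985BackgroundPropagators, (3.3) p.391;
Balaban1984PropagatorsI, (1.31) p.23] -/
theorem DL2_apply_entry_of_dirDiagonal (U₀ : GaugeField (F.P K) 0 (Matrix.specialUnitaryGroup (Fin 2) ℂ)) (δ : Fin (F.P K).d → Fin 2 → ℂ)
    (hU : ∀ b, ((U₀ b : Matrix.specialUnitaryGroup (Fin 2) ℂ) : Matrix (Fin 2) (Fin 2) ℂ) = Matrix.diagonal (δ b.dir))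
    (l : Site (F.P K) 0 → Matrix (Fin 2) (Fin 2) ℂ) (b : PBond (F.P K) 0) (r s : Fin 2) :
    (toL2 F K c₀).symm (DL2 F n K c₀ U₀ (toL2S F K c₀ l)) b r s =
      (((eta F n K : ℝ) : ℂ)⁻¹) * (δ b.dir r * star (δ b.dir s) * l b.tgt r s - l b.src r s) :=
  DL2_apply_entry_of_diagonal U₀ (fun b => δ b.dir) hU l b r s

/-- **THE DIAGONAL ENTRIES ARE FLAT** at a diagonal background with unit entries: `(D_{U₀}λ)(b)_{rr} = η⁻¹·(λ(b₊)_{rr} − λ(b₋)_{rr})` (the `σ₃`∕trace sectors see no background).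
[cite: Balaban1985BackgroundPropagators, (3.3) p.391, p.393] -/
theorem DL2_apply_diagEntry_of_diagonal (U₀ : GaugeField (F.P K) 0 (Matrix.specialUnitaryGroup (Fin 2) ℂ)) (d : PBond (F.P K) 0 → Fin 2 → ℂ)
    (hU : ∀ b, ((U₀ b : Matrix.specialUnitaryGroup (Fin 2) ℂ) : Matrix (Fin 2) (Fin 2) ℂ) = Matrix.diagonal (d b)) (hd : ∀ b i, ‖d b i‖ = 1)
    (l : Site (F.P K) 0 → Matrix (Fin 2) (Fin 2) ℂ) (b : PBond (F.P K) 0) (r : Fin 2) :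
    (toL2 F K c₀).symm (DL2 F n K c₀ U₀ (toL2S F K c₀ l)) b r r =
      (((eta F n K : ℝ) : ℂ)⁻¹) * (l b.tgt r r - l b.src r r) := by
  rw [DL2_apply_entry_of_diagonal U₀ d hU l b r r, mul_conj_self_of_norm_eq_one (hd b) r, one_mul]

end Derivative

/-! ## §3 (3.8) `D*_{U₀}` at a diagonal background, entry by entry -/

section Divergence

variable {F : T3Family} {n K : ℕ} {c₀ : ℝ} [Fact (0 < c₀)]

/-- ★★ **(3.8) AT A BONDWISE-DIAGONAL BACKGROUND, ENTRYWISE**: with `U₀(b) = diag(d(b))`, for every vector field `A`, site `x` and entry `(r, s)`: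
`(D*_{U₀}A)(x)_{rs} = η⁻¹·Σ_μ (conj(d_r(b⁻_μ))·d_s(b⁻_μ)·A(b⁻_μ)_{rs} − A(b⁺_μ)_{rs})`, where `b⁻_μ = (x − e_μ, x)` and `b⁺_μ = (x, x + e_μ)` are the bonds of ✓`DstarL2_apply`
(`R(U(x,x−ηe_μ)) = Ad(U(x−ηe_μ,x))⁻¹` by (3.5)) — the adjoint twisted differences, twist `conj(ω_{rs})`. [cite: Balaban1985BackgroundPropagators, (3.8) p.392, (3.5) p.391] -/
theorem DstarL2_apply_entry_of_diagonal (U₀ : GaugeField (F.P K) 0 (Matrix.specialUnitaryGroup (Fin 2) ℂ)) (d : PBond (F.P K) 0 → Fin 2 → ℂ)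
    (hU : ∀ b, ((U₀ b : Matrix.specialUnitaryGroup (Fin 2) ℂ) : Matrix (Fin 2) (Fin 2) ℂ) = Matrix.diagonal (d b))
    (A : PBond (F.P K) 0 → Matrix (Fin 2) (Fin 2) ℂ) (x : Site (F.P K) 0) (r s : Fin 2) :
    (toL2S F K c₀).symm (DstarL2 F n K c₀ U₀ (toL2 F K c₀ A)) x r s =
      (((eta F n K : ℝ) : ℂ)⁻¹) * ∑ μ : Fin 3,
        (star (d ((bondEquiv F K).symm (B9SectCLatticeCarrier.unshift μ (siteEquiv F K x), μ)) r) *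
            d ((bondEquiv F K).symm (B9SectCLatticeCarrier.unshift μ (siteEquiv F K x), μ)) s *
            A ((bondEquiv F K).symm (B9SectCLatticeCarrier.unshift μ (siteEquiv F K x), μ)) r s -
          A ((bondEquiv F K).symm (siteEquiv F K x, μ)) r s) := by
  rw [DstarL2_apply, Matrix.smul_apply, smul_eq_mul, Matrix.sum_apply]
  refine congrArg _ (Finset.sum_congr rfl fun μ _ => ?_)
  set p : B9SectCLatticeCarrier.Bond 3 (Prop7SectET3Transport.periodsT3 F K) := (B9SectCLatticeCarrier.unshift μ (siteEquiv F K x), μ) with hp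
  have hval : ((bgOfCfg F K U₀ p : (Matrix (Fin 2) (Fin 2) ℂ)ˣ) : Matrix (Fin 2) (Fin 2) ℂ) = Matrix.diagonal (d ((bondEquiv F K).symm p)) := by
    rw [val_bgOfCfg, hU]
  have hinv : ((((bgOfCfg F K U₀ p)⁻¹ : (Matrix (Fin 2) (Fin 2) ℂ)ˣ) : Matrix (Fin 2) (Fin 2) ℂ)) = star (Matrix.diagonal (d ((bondEquiv F K).symm p))) := by
    rw [isUnitaryBg_bgOfCfg, hval]
  rw [Matrix.sub_apply, hinv, hval, star_diagonal_conj_apply]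

/-- ★★ **THE TORON CASE OF (3.8)** — `U₀(⟨x, ν⟩) = diag(δ(ν))`: the backward bond in direction `μ` has `dir = μ`, so
`(D*_{U₀}A)(x)_{rs} = η⁻¹·Σ_μ (conj(δ_r(μ))δ_s(μ)·A(b⁻_μ)_{rs} − A(b⁺_μ)_{rs})` — the translation-invariant adjoint twisted differences, entry by entry.
[cite: Balaban1985BackgroundPropagators, (3.8) p.392; Balaban1984PropagatorsI, (1.31) p.23] -/
theorem DstarL2_apply_entry_of_dirDiagonal (U₀ : GaugeField (F.P K) 0 (Matrix.specialUnitaryGroup (Fin 2) ℂ)) (δ : Fin (F.P K).d → Fin 2 → ℂ)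
    (hU : ∀ b, ((U₀ b : Matrix.specialUnitaryGroup (Fin 2) ℂ) : Matrix (Fin 2) (Fin 2) ℂ) = Matrix.diagonal (δ b.dir))
    (A : PBond (F.P K) 0 → Matrix (Fin 2) (Fin 2) ℂ) (x : Site (F.P K) 0) (r s : Fin 2) :
    (toL2S F K c₀).symm (DstarL2 F n K c₀ U₀ (toL2 F K c₀ A)) x r s =
      (((eta F n K : ℝ) : ℂ)⁻¹) * ∑ μ : Fin 3,
        (star (δ μ r) * δ μ s * A ((bondEquiv F K).symm (B9SectCLatticeCarrier.unshift μ (siteEquiv F K x), μ)) r s -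
          A ((bondEquiv F K).symm (siteEquiv F K x, μ)) r s) := by
  rw [DstarL2_apply_entry_of_diagonal U₀ (fun b => δ b.dir) hU A x r s]
  rfl

/-- **THE DIAGONAL ENTRIES OF (3.8) ARE FLAT** at a diagonal background with unit entries. [cite: Balaban1985BackgroundPropagators, (3.8) p.392, p.393] -/
theorem DstarL2_apply_diagEntry_of_diagonal (U₀ : GaugeField (F.P K) 0 (Matrix.specialUnitaryGroup (Fin 2) ℂ)) (d : PBond (F.P K) 0 → Fin 2 → ℂ)
    (hU : ∀ b, ((U₀ b : Matrix.specialUnitaryGroup (Fin 2) ℂ) : Matrix (Fin 2) (Fin 2) ℂ) = Matrix.diagonal (d b)) (hd : ∀ b i, ‖d b i‖ = 1)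
    (A : PBond (F.P K) 0 → Matrix (Fin 2) (Fin 2) ℂ) (x : Site (F.P K) 0) (r : Fin 2) :
    (toL2S F K c₀).symm (DstarL2 F n K c₀ U₀ (toL2 F K c₀ A)) x r r =
      (((eta F n K : ℝ) : ℂ)⁻¹) * ∑ μ : Fin 3,
        (A ((bondEquiv F K).symm (B9SectCLatticeCarrier.unshift μ (siteEquiv F K x), μ)) r r - A ((bondEquiv F K).symm (siteEquiv F K x, μ)) r r) := by
  rw [DstarL2_apply_entry_of_diagonal U₀ d hU A x r r]
  refine congrArg _ (Finset.sum_congr rfl fun μ _ => ?_)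
  rw [conj_mul_self_of_norm_eq_one (hd _) r, one_mul]

end Divergence

/-! ## §4 (3.23) `Δ^η_{U₀} = D*_{U₀}D_{U₀}` at a toron, entry by entry (v1.1 append) -/

section Laplacian

open Summit.QuantumFields.YangMills.Theorems.Prop7SectET3HilbertLetters (covLapSite)
open Summit.QuantumFields.YangMills.Theorems.Prop7LandauDict (bondEquiv_symm_unshift bondEquiv_symm_siteEquiv)

variable {F : T3Family} {n K : ℕ} {c₀ : ℝ} [Fact (0 < c₀)]

/-- ★★ **(3.23) AT A TORON, ENTRYWISE — THE RAW COMPOSITE**: with `U₀(⟨x, ν⟩) = diag(δ(ν))`, for every `λ`, site `x`, entry `(r, s)` and `ω := δ_r(μ)·conj(δ_s(μ))`: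
`(Δ^η_{U₀}λ)(x)_{rs} = η⁻¹·Σ_μ ( conj(δ_r)δ_s·(η⁻¹(ω·λ(x)_{rs} − λ(x − e_μ)_{rs})) − η⁻¹(ω·λ(x + e_μ)_{rs} − λ(x)_{rs}) )` — `D*` (§3) after `D` (§2), no simplification; the
backward∕forward bonds of ✓`DstarL2_apply` are read as `⟨x − e_μ, μ⟩`∕`⟨x, μ⟩` by ✓`Prop7LandauDict.bondEquiv_symm_unshift`∕`bondEquiv_symm_siteEquiv` and `(x − e_μ) + e_μ = x`
(lit ✓`Site.shift_unshift`). [cite: Balaban1985BackgroundPropagators, (3.23) p.394, (3.3) p.391, (3.8) p.392] -/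
theorem covLapSite_apply_entry_of_dirDiagonal_raw (U₀ : GaugeField (F.P K) 0 (Matrix.specialUnitaryGroup (Fin 2) ℂ)) (δ : Fin (F.P K).d → Fin 2 → ℂ)
    (hU : ∀ b, ((U₀ b : Matrix.specialUnitaryGroup (Fin 2) ℂ) : Matrix (Fin 2) (Fin 2) ℂ) = Matrix.diagonal (δ b.dir))
    (l : Site (F.P K) 0 → Matrix (Fin 2) (Fin 2) ℂ) (x : Site (F.P K) 0) (r s : Fin 2) :
    (toL2S F K c₀).symm (covLapSite F n K c₀ U₀ (toL2S F K c₀ l)) x r s =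
      (((eta F n K : ℝ) : ℂ)⁻¹) * ∑ μ : Fin 3,
        (star (δ μ r) * δ μ s * ((((eta F n K : ℝ) : ℂ)⁻¹) * (δ μ r * star (δ μ s) * l x r s - l (x.unshift μ) r s))
          - (((eta F n K : ℝ) : ℂ)⁻¹) * (δ μ r * star (δ μ s) * l (x.shift μ) r s - l x r s)) := by
  set A : PBond (F.P K) 0 → Matrix (Fin 2) (Fin 2) ℂ := (toL2 F K c₀).symm (DL2 F n K c₀ U₀ (toL2S F K c₀ l)) with hA
  have hA' : DL2 F n K c₀ U₀ (toL2S F K c₀ l) = toL2 F K c₀ A := (LinearEquiv.apply_symm_apply _ _).symm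
  have hAe : ∀ (b : PBond (F.P K) 0), A b r s = (((eta F n K : ℝ) : ℂ)⁻¹) * (δ b.dir r * star (δ b.dir s) * l b.tgt r s - l b.src r s) :=
    fun b => DL2_apply_entry_of_dirDiagonal U₀ δ hU l b r s
  rw [covLapSite, LinearMap.comp_apply, hA', DstarL2_apply_entry_of_dirDiagonal U₀ δ hU A x r s]
  refine congrArg _ (Finset.sum_congr rfl fun μ _ => ?_)
  rw [hAe, hAe, bondEquiv_symm_unshift, bondEquiv_symm_siteEquiv]
  simp only [PBond.tgt, Site.shift_unshift]

/-- ★★★ **(3.23) AT A TORON, ENTRYWISE — THE TWISTED SCALAR LAPLACIAN**: with unit phases (`‖δ_i(ν)‖ = 1`) the `(r, s)` entry of `Δ^η_{U₀}λ` is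
`η⁻²·Σ_μ ( 2·λ(x)_{rs} − conj(ω_{rs,μ})·λ(x − e_μ)_{rs} − ω_{rs,μ}·λ(x + e_μ)_{rs} )`, `ω_{rs,μ} = δ_r(μ)conj(δ_s(μ))`, `conj(ω_{rs,μ}) = δ_s(μ)conj(δ_r(μ))` — i.e.
`η⁻²·Σ_μ (ω_μ S_μ − 1)^*(ω_μ S_μ − 1)`, the operator px10's brick (1) diagonalises with symbol `η⁻²·Σ_μ |ω_μ e^{ip_μ} − 1|²` (✓`ToronTwistedMultipliers.norm_twistedSymbol_sq`);
for `r = s` it is the FLAT Laplacian. [cite: Balaban1985BackgroundPropagators, (3.23) p.394; Balaban1984PropagatorsI, (1.31) p.23] -/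
theorem covLapSite_apply_entry_of_dirDiagonal (U₀ : GaugeField (F.P K) 0 (Matrix.specialUnitaryGroup (Fin 2) ℂ)) (δ : Fin (F.P K).d → Fin 2 → ℂ)
    (hU : ∀ b, ((U₀ b : Matrix.specialUnitaryGroup (Fin 2) ℂ) : Matrix (Fin 2) (Fin 2) ℂ) = Matrix.diagonal (δ b.dir)) (hδ : ∀ ν i, ‖δ ν i‖ = 1)
    (l : Site (F.P K) 0 → Matrix (Fin 2) (Fin 2) ℂ) (x : Site (F.P K) 0) (r s : Fin 2) :
    (toL2S F K c₀).symm (covLapSite F n K c₀ U₀ (toL2S F K c₀ l)) x r s =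
      (((eta F n K : ℝ) : ℂ)⁻¹) ^ 2 * ∑ μ : Fin 3,
        (2 * l x r s - (δ μ s * star (δ μ r)) * l (x.unshift μ) r s - (δ μ r * star (δ μ s)) * l (x.shift μ) r s) := by
  rw [covLapSite_apply_entry_of_dirDiagonal_raw U₀ δ hU l x r s, pow_two, mul_assoc]
  congr 1
  rw [Finset.mul_sum]
  refine Finset.sum_congr rfl fun μ _ => ?_
  -- `conj(δ_r)δ_s·ω = (conj(δ_r)δ_r)(δ_s conj(δ_s)) = 1`
  have hr : star (δ μ r) * δ μ r = 1 := conj_mul_self_of_norm_eq_one (hδ μ) r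
  have hs : δ μ s * star (δ μ s) = 1 := mul_conj_self_of_norm_eq_one (hδ μ) s
  have hω : star (δ μ r) * δ μ s * (δ μ r * star (δ μ s)) = 1 := by
    calc star (δ μ r) * δ μ s * (δ μ r * star (δ μ s)) = (star (δ μ r) * δ μ r) * (δ μ s * star (δ μ s)) := by ring
      _ = 1 := by rw [hr, hs, one_mul]
  linear_combination ((((eta F n K : ℝ) : ℂ)⁻¹) * l x r s) * hω

/-- **THE DIAGONAL ENTRIES OF (3.23) ARE THE FLAT LAPLACIAN** at a toron: `(Δ^η_{U₀}λ)(x)_{rr} = η⁻²·Σ_μ (2λ(x)_{rr} − λ(x − e_μ)_{rr} − λ(x + e_μ)_{rr})`.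
[cite: Balaban1985BackgroundPropagators, (3.23) p.394, p.393] -/
theorem covLapSite_apply_diagEntry_of_dirDiagonal (U₀ : GaugeField (F.P K) 0 (Matrix.specialUnitaryGroup (Fin 2) ℂ)) (δ : Fin (F.P K).d → Fin 2 → ℂ)
    (hU : ∀ b, ((U₀ b : Matrix.specialUnitaryGroup (Fin 2) ℂ) : Matrix (Fin 2) (Fin 2) ℂ) = Matrix.diagonal (δ b.dir)) (hδ : ∀ ν i, ‖δ ν i‖ = 1)
    (l : Site (F.P K) 0 → Matrix (Fin 2) (Fin 2) ℂ) (x : Site (F.P K) 0) (r : Fin 2) :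
    (toL2S F K c₀).symm (covLapSite F n K c₀ U₀ (toL2S F K c₀ l)) x r r =
      (((eta F n K : ℝ) : ℂ)⁻¹) ^ 2 * ∑ μ : Fin 3, (2 * l x r r - l (x.unshift μ) r r - l (x.shift μ) r r) := by
  rw [covLapSite_apply_entry_of_dirDiagonal U₀ δ hU hδ l x r r]
  refine congrArg _ (Finset.sum_congr rfl fun μ _ => ?_)
  rw [mul_conj_self_of_norm_eq_one (hδ μ) r, one_mul, one_mul]

end Laplacian


end Summit.QuantumFields.YangMills.Theorems.ToronSectorStencils

end
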